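import Mathlib
import Summits.AtomisticToContinuum.Crystallization.Theorems.ThreeConeCertificateExactCertificateTransfer1DMinGap
import Literature.MathematicalPhysics.StatisticalMechanics.Crystallization
import Literature.MathematicalPhysics.StatisticalMechanics.LennardJonesClusters

/-!
# Crux `ExactCertificate` (stmt-AtomisticToContinuum-11959), line `closure-makes-nogap-exact`, Transfer skeleton IV
# (`SlackRigidity1D`, slack rigidity of the Lennard-Jones chain): two sharpenings of the d = 1 budget

Support file (`--supports stmt-AtomisticToContinuum-11959`); nothing here closes the 3-D crux.  The assembly of Transfer
skeleton IV (`SlackRigidity` with `3 ↦ 1`, file `…Transfer1DSlack.lean`) needs two facts about the zero-pressure lattice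
constant `a` (`Σ_{m≥1} m V′(ma) = 0`, i.e. `a⁶ ζ(6) = ζ(12)`) beyond c7's `stub_aBounds` (`3/4 ≤ a ≤ 1`):

* `slack_a_sharp` — `a < 1` STRICTLY (because `ζ(12) < ζ(6)` strictly) and `a⁶ > 1/2` (because `ζ(12) ≥ 1` and
  `ζ(6) ≤ 9/8`, the latter from the tree's partial-sum bound `minGap_sum_inv_pow_six`);
* `slack_eA_nonpos` — hence the chain's energy per particle `e_a = Σ_{m≥1} V(ma)` is `≤ 0` (every term is: `(ma)⁶ > 1/2`);
* `stub_slackBudget` — the registered stub (G) of the skeleton: both facts together.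

`a < 1` is what makes a contracted gap (`= 1`) visibly defective (`|a − 1| = 1 − a > 0`), and `e_a ≤ 0` is what lets the
Kepler bound at `N − m` particles control the number `m` of crowding deletions.  All `[folklore]`.
-/

noncomputable section

namespace Summit.AtomisticToContinuum.Crystallization.Theorems.ThreeConeCertificateExactCertificate.Transfer1D

open Literature.MathematicalPhysics.StatisticalMechanics
open scoped BigOperators

/-! ## Two sharpenings of the budget: `a < 1` strictly, and `e_a ≤ 0` -/

/-- **The zero-pressure lattice constant is `< 1` and has `a⁶ > 1/2`.**  From `a⁶·ζ(6) = ζ(12)` (zero pressure):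
`ζ(12) < ζ(6)` strictly gives `a < 1`, and `ζ(12) ≥ 1`, `ζ(6) ≤ 9/8` give `a⁶ ≥ 8/9 > 1/2`. [folklore] -/
theorem slack_a_sharp : ∀ a : ℝ, 0 < a →
    HasSum (fun k : ℕ => ((k : ℝ) + 1) * ((((k : ℝ) + 1) * a)⁻¹ ^ 7 - (((k : ℝ) + 1) * a)⁻¹ ^ 13)) 0 →
    a < 1 ∧ 1 / 2 < a ^ 6 := by
  intro a ha hz
  have hane : a ≠ 0 := ha.ne'
  have hs6 : Summable (fun k : ℕ => ((k : ℝ) + 1)⁻¹ ^ 6) := by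
    have h' := (summable_nat_add_iff 1).2 (Real.summable_nat_pow_inv.2 (by norm_num : 1 < 6))
    refine h'.congr fun k => ?_
    push_cast
    rw [inv_pow]
  have hs12 : Summable (fun k : ℕ => ((k : ℝ) + 1)⁻¹ ^ 12) := by
    have h' := (summable_nat_add_iff 1).2 (Real.summable_nat_pow_inv.2 (by norm_num : 1 < 12))
    refine h'.congr fun k => ?_
    push_cast
    rw [inv_pow]
  set Z6 : ℝ := ∑' k : ℕ, ((k : ℝ) + 1)⁻¹ ^ 6 with hZ6
  set Z12 : ℝ := ∑' k : ℕ, ((k : ℝ) + 1)⁻¹ ^ 12 with hZ12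
  have hZ6pos : 0 < Z6 :=
    lt_of_lt_of_le (by norm_num : (0 : ℝ) < ((((0 : ℕ) : ℝ) + 1)⁻¹ ^ 6))
      (le_hasSum hs6.hasSum 0 fun k _ => by positivity)
  have hZ12one : 1 ≤ Z12 := by
    have h := le_hasSum hs12.hasSum 0 fun k _ => by positivity
    have h0 : (((0 : ℕ) : ℝ) + 1)⁻¹ ^ 12 = 1 := by norm_num
    rw [h0] at h
    exact h
  -- `Z12 < Z6` strictly (strict at `k = 1`) and `Z6 ≤ 9/8`
  have hZ12lt : Z12 < Z6 := by
    refine Summable.tsum_lt_tsum_of_nonneg (i := 1) (fun k => by positivity) (fun k => ?_) ?_ hs6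
    · have hk1 : ((k : ℝ) + 1)⁻¹ ≤ 1 := inv_le_one_of_one_le₀ (by linarith [(k.cast_nonneg : (0 : ℝ) ≤ k)])
      exact pow_le_pow_of_le_one (by positivity) hk1 (by norm_num)
    · norm_num
  have hZ6le : Z6 ≤ 9 / 8 :=
    Real.tsum_le_of_sum_range_le (fun n => by positivity) fun n => minGap_sum_inv_pow_six n
  -- the zero-pressure identity `a⁻⁷ Z6 − a⁻¹³ Z12 = 0`, i.e. `a⁶ Z6 = Z12`
  have hterm : ∀ k : ℕ, ((k : ℝ) + 1) * ((((k : ℝ) + 1) * a)⁻¹ ^ 7 - (((k : ℝ) + 1) * a)⁻¹ ^ 13)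
      = a⁻¹ ^ 7 * ((k : ℝ) + 1)⁻¹ ^ 6 - a⁻¹ ^ 13 * ((k : ℝ) + 1)⁻¹ ^ 12 := by
    intro k
    have hk : (k : ℝ) + 1 ≠ 0 := by positivity
    rw [mul_inv, mul_pow, mul_pow]
    field_simp
  have hsum : HasSum (fun k : ℕ => a⁻¹ ^ 7 * ((k : ℝ) + 1)⁻¹ ^ 6 - a⁻¹ ^ 13 * ((k : ℝ) + 1)⁻¹ ^ 12)
      (a⁻¹ ^ 7 * Z6 - a⁻¹ ^ 13 * Z12) :=
    (hs6.hasSum.mul_left _).sub (hs12.hasSum.mul_left _)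
  have hz' : HasSum (fun k : ℕ => a⁻¹ ^ 7 * ((k : ℝ) + 1)⁻¹ ^ 6 - a⁻¹ ^ 13 * ((k : ℝ) + 1)⁻¹ ^ 12) 0 := by
    have hfun : (fun k : ℕ => ((k : ℝ) + 1) * ((((k : ℝ) + 1) * a)⁻¹ ^ 7 - (((k : ℝ) + 1) * a)⁻¹ ^ 13))
        = fun k : ℕ => a⁻¹ ^ 7 * ((k : ℝ) + 1)⁻¹ ^ 6 - a⁻¹ ^ 13 * ((k : ℝ) + 1)⁻¹ ^ 12 :=
      funext hterm
    rw [← hfun]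
    exact hz
  have heq : a⁻¹ ^ 7 * Z6 - a⁻¹ ^ 13 * Z12 = 0 := hsum.unique hz'
  have hkey : a ^ 6 * Z6 = Z12 := by
    have h1 : a⁻¹ ^ 7 * Z6 = a⁻¹ ^ 13 * Z12 := by linarith
    have h2 : a ^ 13 * (a⁻¹ ^ 7 * Z6) = a ^ 13 * (a⁻¹ ^ 13 * Z12) := by rw [h1]
    have h3 : a ^ 13 * (a⁻¹ ^ 7 * Z6) = a ^ 6 * Z6 := by
      rw [inv_pow, ← mul_assoc, show a ^ 13 = a ^ 6 * a ^ 7 by ring, mul_assoc (a ^ 6),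
        mul_inv_cancel₀ (pow_ne_zero 7 hane), mul_one]
    have h4 : a ^ 13 * (a⁻¹ ^ 13 * Z12) = Z12 := by
      rw [inv_pow, ← mul_assoc, mul_inv_cancel₀ (pow_ne_zero 13 hane), one_mul]
    rw [← h3, h2, h4]
  constructor
  · -- `a < 1`: otherwise `Z6 ≤ a⁶ Z6 = Z12 < Z6`
    by_contra hge
    rw [not_lt] at hge
    have h6 : 1 ≤ a ^ 6 := one_le_pow₀ hge
    nlinarith
  · -- `a⁶ = Z12/Z6 ≥ 8/9 > 1/2`
    nlinarith

/-- **The chain's energy per particle is `≤ 0`:** `e_a = Σ_{m≥1} V(ma) ≤ 0` termwise, since `(ma)⁶ ≥ a⁶ > 1/2` and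
`V(r) = (u/12)(u − 2) ≤ 0` for `u = r⁻⁶ ≤ 2`. [folklore] -/
theorem slack_eA_nonpos : ∀ a : ℝ, 0 < a → 1 / 2 < a ^ 6 → ∑' k : ℕ, lennardJones (((k : ℝ) + 1) * a) ≤ 0 := by
  intro a ha ha6
  refine tsum_nonpos fun k => ?_
  have hk : (0 : ℝ) ≤ k := k.cast_nonneg
  have hr : a ≤ ((k : ℝ) + 1) * a := le_mul_of_one_le_left ha.le (by linarith)
  have hr0 : 0 < ((k : ℝ) + 1) * a := by positivity
  have hr6 : 1 / 2 < (((k : ℝ) + 1) * a) ^ 6 := lt_of_lt_of_le ha6 (pow_le_pow_left₀ ha.le hr 6)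
  have hu : ((((k : ℝ) + 1) * a)⁻¹) ^ 6 ≤ 2 := by
    rw [inv_pow, inv_le_comm₀ (by positivity) (by norm_num)]
    linarith
  have hu0 : 0 ≤ ((((k : ℝ) + 1) * a)⁻¹) ^ 6 := by positivity
  unfold lennardJones
  have h12 : ((((k : ℝ) + 1) * a)⁻¹) ^ 12 = (((((k : ℝ) + 1) * a)⁻¹) ^ 6) ^ 2 := by ring
  rw [h12]
  nlinarith [mul_nonneg hu0 (sub_nonneg.2 hu)]


/-- **Registered stub `stub_slackBudget`** (Transfer skeleton IV, v2): for the zero-pressure lattice constant `a`,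
`a < 1` strictly and `e_a = Σ_{m≥1} V(ma) ≤ 0` (`slack_a_sharp` + `slack_eA_nonpos`). [folklore] -/
theorem stub_slackBudget : ∀ a : ℝ, 0 < a →
    HasSum (fun k : ℕ => ((k : ℝ) + 1) * ((((k : ℝ) + 1) * a)⁻¹ ^ 7 - (((k : ℝ) + 1) * a)⁻¹ ^ 13)) 0 →
    a < 1 ∧ ∑' k : ℕ, lennardJones (((k : ℝ) + 1) * a) ≤ 0 := fun a ha hz =>
  ⟨(slack_a_sharp a ha hz).1, slack_eA_nonpos a ha (slack_a_sharp a ha hz).2⟩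

end Summit.AtomisticToContinuum.Crystallization.Theorems.ThreeConeCertificateExactCertificate.Transfer1D

end
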